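import Literature.NumberTheory.GaloisRepresentations.GlobalArtinMapOfCharactersProofs
import Literature.NumberTheory.GaloisRepresentations.WeakAbelianDirectSummandProofs
import Literature.NumberTheory.EllipticCurves.DeShalit1987.LMeasureAvatarRigidity
import Literature.NumberTheory.NumberFields.RayClassFieldIdelic
import Literature.NumberTheory.GaloisRepresentations.FiniteGaloisCharacterPadicAvatar
import HarnessLib

/-!
# The finite-order Hecke character of a `p`-adic character of `Gal(L/K)` and its `p`-adic avatar

Topic `NumberTheory/EllipticCurves/DeShalit1987` (next to `LMeasureAvatarRigidity.lean`, whose rigidity it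
uses); namespace `Literature.NumberTheory.EllipticCurves`. Proof file (theorems only; no definition, no named
fact, no instance). De Shalit II.4.13 (p. 69) / II.4.16 (49)–(50): "a character `χ` of finite order of
`𝒢 = Gal(K(𝔣p^∞)/K)`" IS a Grössencharacter of finite order (of conductor dividing `𝔣p^∞`), and as such it
enters the interpolation range `ε = φ^kφ̄^{-j}χ`; the uniqueness half of II.4.12 tests a measure against
exactly these `χ`. In the tree's dictionary (`IsPAdicAvatarOf ι φ r`, `BDPAnticyclotomicPAdicLFunction.lean`:
"`r(Frob_v^geom) = ι⁻¹(φ(ϖ_v))`") this is the following bookkeeping, all of whose inputs the tree PROVES: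
Artin reciprocity for characters (`artinReciprocity_character_holds`), the Hecke character
`charHecke L ψ hR` of a character `ψ` of `Gal(L/K)` with `ω(ϖ_v) = ψ(Frob_v)` at the primes unramified in `L`
(`GlobalArtinMapOfCharactersProofs.lean`), "inertia dies, Frobenius restricts to Frobenius"
(`absRestrictNormalHom_eq_one_of_isUnramifiedIn`, `isArithFrobAt_absRestrictNormalHom`, `eq_galFrob`), and the
rigidity "a relative avatar of an algebraic character is THE avatar" (`IsPAdicAvatarOutside.isPAdicAvatarOf`).

## Statements (`K` a number field, `L ⊆ K̄` finite abelian over `K`, `ι : ℚ̄_p ≃ ℂ`)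

For a character `χ : Gal(L/K) →* ℚ̄_pˣ` and ANY rank-one framed `r : Γ_K → GL₁(ℚ̄_p)` with
`r(γ) = (χ(γ|_L))` (hypothesis `hr`; binder style, no new definition — such an `r` exists,
`exists_framedGaloisRep_apply_eq`), and the finite-order Hecke character
**`ω := charHecke L ((Units.map ι) ∘ χ⁻¹) artinReciprocity_character_holds`** — NOTE THE INVERSE: the
dictionary is "uniformizer ↦ geometric Frobenius", so the Hecke character whose avatar is `χ` has
`ω(ϖ_v) = ι(χ(Frob_v))⁻¹`:

* `entry_eq_of_apply_eq`, `isUnramifiedAt_of_apply_eq`, `hasFrobCharpolyAt_of_apply_eq` — `r` is unramified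
  at every prime `v` unramified in `L`, with Frobenius characteristic polynomial `X − χ(Frob_v)`;
* `charHecke_inv_valueAtUniformizer`, `symm_charHecke_inv_valueAtUniformizer_inv`
  — `ω(ϖ_v) = ι(χ(Frob_v))⁻¹`, `(ι⁻¹(ω(ϖ_v)))⁻¹ = χ(Frob_v)` at `v` unramified in `L`;
* ★★ `isPAdicAvatarOutside_charHecke_inv` — `r` is an avatar of `ω` outside any `S ⊇` the primes ramified in `L`;
* ★★★ `isPAdicAvatarOf_charHecke_inv` — **`r` IS the `p`-adic avatar of `ω`** (absolute form);
* ★ `exists_isFiniteOrder_isPAdicAvatarOf` — packaged: **for every `χ` (and `r` as above) there is a Hecke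
  character `ω` of finite order, unramified with `ω(ϖ_v) = ι(χ(Frob_v))⁻¹` at every prime unramified in `L`,
  with `IsPAdicAvatarOf ι ω r`**, unique (`eq_charHecke_inv_of_isPAdicAvatarOf`: any Hecke character with
  avatar `r` is `ω`);
* `exists_isFiniteOrder_isPAdicAvatarOf_rayClassField` — the case `L = rayClassField K 𝔪` (`𝔪 ≠ 0`):
  `ω` is unramified at every `v ∤ 𝔪` (the characters of `Gal(K(𝔪)/K)`, de Shalit's `χ` of conductor `∣ 𝔪`).

* (appended §5) bridge to the named API of `GaloisRepresentations/FiniteGaloisCharacterPadicAvatar.lean`: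
  `padicCharHecke_inv_eq` (`padicCharHecke L ι χ⁻¹ = ω`), ★★ `isPAdicAvatarOf_padicCharHecke_inflateCharacterPadic_inv`
  (`IsPAdicAvatarOf ι (padicCharHecke L ι χ) (inflateCharacterPadic L χ⁻¹)` for EVERY finite abelian `L` — no ramification
  proviso), `eq_padicCharHecke_of_isPAdicAvatarOf` (uniqueness).

References: E. de Shalit (1987), II.4.12–4.13 (p. 68–69), II.4.16 (49)–(50) (p. 76–77) [deShalit1987];
J. Tate, *Global class field theory*, Cassels–Fröhlich Ch. VII §3.1, §4.2 Cor., §5.1 (A) [CasselsFrohlichANT1967];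
J.-P. Serre, *Abelian ℓ-adic representations* (1968), Ch. I §2.3, Ch. II §2.7 [SerreAbelianLadic1968];
J. Neukirch, *Algebraic Number Theory* (1999), Ch. VI (6.2), (6.6), Ch. VII §10 (10.6) [NeukirchANT1999].

Mathlib / tree search: tree `charHecke`, `charHecke_isFiniteOrder`, `charHecke_isUnramifiedAt`,
`charHecke_valueAtUniformizer`, `charHecke_unique`, `inflateCharacter` (the `ℂ`-valued twin of `r`),
`absRestrictNormalHom_eq_one_of_isUnramifiedIn`, `isArithFrobAt_absRestrictNormalHom`, `eq_galFrob`,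
`FramedGaloisRep.charpoly_eq_of_rank_one`, `FramedRep.unitsContinuousMulEquivOfUnique_apply_coe`,
`IsFiniteOrder.isAlgebraic`, `IsPAdicAvatarOutside.isPAdicAvatarOf`, `finite_setOf_not_isUnramifiedIn`,
`isUnramifiedIn_rayClassField`, `MonoidHom.continuous_of_isOpen_ker`, `isOpen_ker_absRestrictNormalHom`
(`lean search 'isPAdicAvatarOf.*charHecke|charHecke.*[Aa]vatar'` — nothing).
-/

noncomputable section

open NumberField IsDedekindDomain IsDedekindDomain.HeightOneSpectrum Field Polynomial Filter

namespace Literature.NumberTheory.EllipticCurves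

open Literature.NumberTheory.GaloisRepresentations Literature.NumberTheory.NumberFields

variable {K : Type} [Field K] [NumberField K] {p : ℕ} [Fact p.Prime]
variable (L : IntermediateField K (AlgebraicClosure K)) [FiniteDimensional K L] [NumberField L]

/-! ### §1. The rank-one framed representation `γ ↦ (χ(γ|_L))` -/

section Inflate

variable [Normal K L] (χ : (L ≃ₐ[K] L) →* (PadicAlgCl p)ˣ)

omit [NumberField K] [NumberField L] in
/-- **The inflated character exists as a framed representation**: `γ ↦ (χ(γ|_L)) ∈ GL₁(ℚ̄_p)` is a
continuous homomorphism on `Γ_K` (trivial on the open subgroup `Gal(K̄/L)`; the `ℚ̄_p`-valued twin of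
`inflateCharacter`). [cite: CasselsFrohlichANT1967, Ch. VII §3 (PDF p. 210)] -/
theorem exists_framedGaloisRep_apply_eq :
    ∃ r : FramedGaloisRep K (PadicAlgCl p) 1, ∀ γ : absoluteGaloisGroup K,
      r γ = FramedRep.unitsContinuousMulEquivOfUnique (Fin 1) (PadicAlgCl p) (χ (absRestrictNormalHom L γ)) :=
  ⟨ContinuousMonoidHom.comp
    (FramedRep.unitsContinuousMulEquivOfUnique (Fin 1) (PadicAlgCl p) :
      (PadicAlgCl p)ˣ →ₜ* GL (Fin 1) (PadicAlgCl p))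
    ⟨χ.comp (absRestrictNormalHom L),
      MonoidHom.continuous_of_isOpen_ker _
        (Subgroup.isOpen_mono (fun γ hγ => by
          rw [MonoidHom.mem_ker] at hγ ⊢
          rw [MonoidHom.comp_apply, hγ, map_one]) (isOpen_ker_absRestrictNormalHom L))⟩,
    fun _ ↦ rfl⟩

variable {L χ} {r : FramedGaloisRep K (PadicAlgCl p) 1}
  (hr : ∀ γ : absoluteGaloisGroup K,
    r γ = FramedRep.unitsContinuousMulEquivOfUnique (Fin 1) (PadicAlgCl p) (χ (absRestrictNormalHom L γ)))
include hr

omit [NumberField K] [FiniteDimensional K L] [NumberField L] in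
/-- The matrix entry of `r(γ)` is `χ(γ|_L)` (the rank-one representation "`χ ∘ r_L`" of a character of the
Galois group). [cite: CasselsFrohlichANT1967, Ch. VII §3 (PDF p. 210)] -/
theorem entry_eq_of_apply_eq (γ : absoluteGaloisGroup K) :
    ((r γ : GL (Fin 1) (PadicAlgCl p)) : Matrix (Fin 1) (Fin 1) (PadicAlgCl p)) 0 0 =
      ((χ (absRestrictNormalHom L γ) : (PadicAlgCl p)ˣ) : PadicAlgCl p) := by
  rw [hr, FramedRep.unitsContinuousMulEquivOfUnique_apply_coe]

end Inflate

section Galois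

variable [IsAbelianGalois K L] {L} {χ : (L ≃ₐ[K] L) →* (PadicAlgCl p)ˣ}
  {r : FramedGaloisRep K (PadicAlgCl p) 1}
  (hr : ∀ γ : absoluteGaloisGroup K,
    r γ = FramedRep.unitsContinuousMulEquivOfUnique (Fin 1) (PadicAlgCl p) (χ (absRestrictNormalHom L γ)))
include hr

omit [FiniteDimensional K L] in
/-- **`r` is unramified at every prime unramified in `L`** (the inertia groups of `Γ_K` above such a prime
die in `Gal(L/K)`). [cite: CasselsFrohlichANT1967, Ch. VII §3.1] [cite: NeukirchANT1999, Ch. VII §10 Thm. (10.6) (proof)] -/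
theorem isUnramifiedAt_of_apply_eq {v : HeightOneSpectrum (𝓞 K)}
    (hunr : Algebra.IsUnramifiedIn (𝓞 L) v.asIdeal) : r.IsUnramifiedAt v := by
  intro 𝔓 h𝔓 g hg
  rw [hr, absRestrictNormalHom_eq_one_of_isUnramifiedIn L hunr h𝔓 hg, map_one, map_one]

omit [FiniteDimensional K L] in
/-- **At a prime `v` unramified in the abelian `L`, the Frobenius characteristic polynomial of `r` is
`X − χ(Frob_v)`** (`Frob_v = galFrob K L v`; an arithmetic Frobenius of `Γ_K` above `v` restricts to THE
Frobenius of the abelian `Gal(L/K)`). [cite: CasselsFrohlichANT1967, Ch. VII §2.1–§2.2 and §3.1] -/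
theorem hasFrobCharpolyAt_of_apply_eq {v : HeightOneSpectrum (𝓞 K)}
    (hunr : Algebra.IsUnramifiedIn (𝓞 L) v.asIdeal) :
    r.HasFrobCharpolyAt v (X - C ((χ (galFrob K L v) : (PadicAlgCl p)ˣ) : PadicAlgCl p)) := by
  intro 𝔓 h𝔓 σ hσ
  haveI : 𝔓.IsPrime := h𝔓.1
  have hP := comap_ringOfIntegersToIntegralClosure_mem_primesOver_of_mem_primesAbove L h𝔓
  have hrσ := isArithFrobAt_absRestrictNormalHom L hσ
  have heq : absRestrictNormalHom L σ = galFrob K L v :=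
    eq_galFrob (commute_of_isAbelianGalois L) hunr hP hrσ
  rw [FramedGaloisRep.charpoly_eq_of_rank_one, entry_eq_of_apply_eq hr, heq]

end Galois

/-! ### §2. The Hecke character `ω = charHecke L (ι ∘ χ⁻¹)` and its values -/

section Values

variable (ι : PadicAlgCl p ≃+* ℂ) (χ : (L ≃ₐ[K] L) →* (PadicAlgCl p)ˣ)

omit [FiniteDimensional K L] [NumberField L] [NumberField K] in
/-- `((Units.map ι) ∘ χ⁻¹)(g) = ι(χ(g))⁻¹` in `ℂ` (plumbing). [folklore] -/
private theorem coe_unitsMap_comp_inv_apply (g : L ≃ₐ[K] L) :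
    ((((Units.map (ι.toRingHom : PadicAlgCl p →* ℂ)).comp χ⁻¹) g : ℂˣ) : ℂ) =
      (ι ((χ g : (PadicAlgCl p)ˣ) : PadicAlgCl p))⁻¹ := by
  rw [MonoidHom.comp_apply, MonoidHom.inv_apply, Units.coe_map, Units.val_inv_eq_inv_val]
  exact map_inv₀ ι _

variable [IsAbelianGalois K L]

/-- **`ω(ϖ_v) = ι(χ(Frob_v))⁻¹`** at every prime `v` unramified in `L`, for
`ω = charHecke L ((Units.map ι) ∘ χ⁻¹) hR`. [cite: CasselsFrohlichANT1967, Ch. VII §4.2 Corollary (iii)] -/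
theorem charHecke_inv_valueAtUniformizer {v : HeightOneSpectrum (𝓞 K)}
    (hunr : Algebra.IsUnramifiedIn (𝓞 L) v.asIdeal) :
    (charHecke L ((Units.map (ι.toRingHom : PadicAlgCl p →* ℂ)).comp χ⁻¹)
        artinReciprocity_character_holds).valueAtUniformizer v =
      (ι ((χ (galFrob K L v) : (PadicAlgCl p)ˣ) : PadicAlgCl p))⁻¹ := by
  rw [charHecke_valueAtUniformizer L _ artinReciprocity_character_holds hunr, coe_unitsMap_comp_inv_apply]

/-- **`(ι⁻¹(ω(ϖ_v)))⁻¹ = χ(Frob_v)`** — the constant of the Frobenius characteristic polynomial demanded by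
`IsPAdicAvatarOf`. [cite: SerreAbelianLadic1968, Ch. II §2.7] -/
theorem symm_charHecke_inv_valueAtUniformizer_inv {v : HeightOneSpectrum (𝓞 K)}
    (hunr : Algebra.IsUnramifiedIn (𝓞 L) v.asIdeal) :
    (ι.symm ((charHecke L ((Units.map (ι.toRingHom : PadicAlgCl p →* ℂ)).comp χ⁻¹)
        artinReciprocity_character_holds).valueAtUniformizer v))⁻¹ =
      ((χ (galFrob K L v) : (PadicAlgCl p)ˣ) : PadicAlgCl p) := by
  rw [charHecke_inv_valueAtUniformizer L ι χ hunr, map_inv₀, RingEquiv.symm_apply_apply, inv_inv]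

end Values

/-! ### §3. `r` is the `p`-adic avatar of `ω` -/

section Avatar

variable [IsAbelianGalois K L] {L} (ι : PadicAlgCl p ≃+* ℂ) {χ : (L ≃ₐ[K] L) →* (PadicAlgCl p)ˣ}
  {r : FramedGaloisRep K (PadicAlgCl p) 1}
  (hr : ∀ γ : absoluteGaloisGroup K,
    r γ = FramedRep.unitsContinuousMulEquivOfUnique (Fin 1) (PadicAlgCl p) (χ (absRestrictNormalHom L γ)))
include hr

/-- ★★ **`r` is an avatar of `ω` outside the ramified primes**: for any finite `S` containing every prime
ramified in `L`, `IsPAdicAvatarOutside S ι ω r` (unramified with charpoly `X − χ(Frob_v) = X − (ι⁻¹ω(ϖ_v))⁻¹`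
at every `v ∉ S`). [cite: CasselsFrohlichANT1967, Ch. VII §4.2 Corollary (iii)] [cite: SerreAbelianLadic1968, Ch. II §2.7] -/
theorem isPAdicAvatarOutside_charHecke_inv {S : Finset (HeightOneSpectrum (𝓞 K))}
    (hS : ∀ v : HeightOneSpectrum (𝓞 K), v ∉ S → Algebra.IsUnramifiedIn (𝓞 L) v.asIdeal) :
    IsPAdicAvatarOutside S ι
      (charHecke L ((Units.map (ι.toRingHom : PadicAlgCl p →* ℂ)).comp χ⁻¹)
        artinReciprocity_character_holds) r := by
  intro v hvS _ _
  have hunr := hS v hvS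
  refine ⟨isUnramifiedAt_of_apply_eq hr hunr, ?_⟩
  rw [symm_charHecke_inv_valueAtUniformizer_inv L ι χ hunr]
  exact hasFrobCharpolyAt_of_apply_eq hr hunr

/-- ★★★ **`r = (χ(·|_L))` IS the `p`-adic avatar of the finite-order Hecke character
`ω = charHecke L ((Units.map ι) ∘ χ⁻¹) hR`** (absolute form: only finitely many primes ramify in `L`, and a
relative avatar of an algebraic — here finite-order — character is its avatar, by Chebotarev rigidity).
[cite: SerreAbelianLadic1968, Ch. I §2.3, Ch. II §2.7] [cite: CasselsFrohlichANT1967, Ch. VII §5.1 Main Theorem (A)] -/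
theorem isPAdicAvatarOf_charHecke_inv :
    IsPAdicAvatarOf ι
      (charHecke L ((Units.map (ι.toRingHom : PadicAlgCl p →* ℂ)).comp χ⁻¹)
        artinReciprocity_character_holds) r := by
  classical
  have hfin := finite_setOf_not_isUnramifiedIn K L
  refine (isPAdicAvatarOutside_charHecke_inv ι hr (S := hfin.toFinset) fun v hv ↦ ?_).isPAdicAvatarOf
    (charHecke_isFiniteOrder L _ artinReciprocity_character_holds).isAlgebraic
  by_contra h
  exact hv (hfin.mem_toFinset.mpr h)

/-- **Uniqueness**: a Hecke character whose `p`-adic avatar is `r = (χ(·|_L))` is `ω` (its values at the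
uniformizers agree with `ι(χ(Frob_v))⁻¹` at almost every prime; rigidity
`HeckeCharacter.ext_of_eventually_valueAtUniformizer_eq`). [cite: CasselsFrohlichANT1967, Ch. VII Prop. 4.1 (uniqueness)] -/
theorem eq_charHecke_inv_of_isPAdicAvatarOf {ω : HeckeCharacter K} (hω : IsPAdicAvatarOf ι ω r) :
    ω = charHecke L ((Units.map (ι.toRingHom : PadicAlgCl p →* ℂ)).comp χ⁻¹)
      artinReciprocity_character_holds := by
  classical
  refine charHecke_unique L _ artinReciprocity_character_holds ?_
  have h1 : ∀ᶠ v : HeightOneSpectrum (𝓞 K) in cofinite, Algebra.IsUnramifiedIn (𝓞 L) v.asIdeal :=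
    eventually_isUnramifiedIn L
  have h2 : ∀ᶠ v : HeightOneSpectrum (𝓞 K) in cofinite, ω.IsUnramifiedAt v :=
    ω.finite_ramifiedPlaces_iff.1 (HeckeCharacter.finite_ramifiedPlaces_holds ω)
  have h3 : ∀ᶠ v : HeightOneSpectrum (𝓞 K) in cofinite, ((p : ℕ) : 𝓞 K) ∉ v.asIdeal := by
    rw [eventually_cofinite]
    have hp0 : ((p : ℕ) : 𝓞 K) ≠ 0 := by exact_mod_cast (Fact.out : p.Prime).ne_zero
    exact (Ideal.finite_factors (Ideal.span_singleton_eq_bot.not.mpr hp0)).subset fun v hv ↦ by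
      simpa [Ideal.dvd_span_singleton] using hv
  filter_upwards [h1, h2, h3] with v hunr hωv hpv
  obtain ⟨𝔓, h𝔓⟩ := v.primesAbove_nonempty
  obtain ⟨σ, hσ⟩ := HeightOneSpectrum.exists_isArithFrobAt_of_mem_primesAbove_holds h𝔓
  have ha := (FramedGaloisRep.hasFrobCharpolyAt_iff_of_rank_one r v _).mp (hω v hpv hωv).2 𝔓 h𝔓 σ hσ
  have hb := (FramedGaloisRep.hasFrobCharpolyAt_iff_of_rank_one r v _).mp
    (hasFrobCharpolyAt_of_apply_eq hr hunr) 𝔓 h𝔓 σ hσ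
  rw [ha] at hb
  -- `(ι⁻¹ ω(ϖ_v))⁻¹ = χ(Frob_v)` ⇒ `ω(ϖ_v) = ι(χ(Frob_v))⁻¹`
  rw [coe_unitsMap_comp_inv_apply, ← hb, map_inv₀, RingEquiv.apply_symm_apply, inv_inv]

omit hr in
/-- ★ **Packaged: every `p`-adic character of `Gal(L/K)` is the avatar of a finite-order Hecke character.**
For `χ : Gal(L/K) →* ℚ̄_pˣ` and any framed `r = (χ(·|_L))`, there is a Hecke character `ω` of `K` of finite
order, unramified at every prime `v` unramified in `L` with `ω(ϖ_v) = ι(χ(Frob_v))⁻¹` there, whose `p`-adic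
avatar is `r`. (De Shalit II.4.13: "characters of finite order of `𝒢`" as Grössencharacters.)
[cite: deShalit1987, II.4.13 (p. 69)] [cite: CasselsFrohlichANT1967, Ch. VII §5.1 Main Theorem (A)] -/
theorem exists_isFiniteOrder_isPAdicAvatarOf (χ : (L ≃ₐ[K] L) →* (PadicAlgCl p)ˣ)
    {r : FramedGaloisRep K (PadicAlgCl p) 1}
    (hr : ∀ γ : absoluteGaloisGroup K,
      r γ = FramedRep.unitsContinuousMulEquivOfUnique (Fin 1) (PadicAlgCl p) (χ (absRestrictNormalHom L γ))) :
    ∃ ω : HeckeCharacter K, ω.IsFiniteOrder ∧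
      (∀ v : HeightOneSpectrum (𝓞 K), Algebra.IsUnramifiedIn (𝓞 L) v.asIdeal →
        ω.IsUnramifiedAt v ∧
          ω.valueAtUniformizer v = (ι ((χ (galFrob K L v) : (PadicAlgCl p)ˣ) : PadicAlgCl p))⁻¹) ∧
      IsPAdicAvatarOf ι ω r :=
  ⟨_, charHecke_isFiniteOrder L _ artinReciprocity_character_holds,
    fun _ hunr ↦ ⟨charHecke_isUnramifiedAt L _ artinReciprocity_character_holds hunr,
      charHecke_inv_valueAtUniformizer L ι χ hunr⟩,
    isPAdicAvatarOf_charHecke_inv ι hr⟩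

end Avatar

/-! ### §4. The ray class field `K(𝔪)` -/

/-- **The characters of `Gal(K(𝔪)/K)` as finite-order Hecke characters unramified outside `𝔪`** with
prescribed `p`-adic avatar: for `𝔪 ≠ 0`, `χ : Gal(K(𝔪)/K) →* ℚ̄_pˣ` and any framed `r = (χ(·|_{K(𝔪)}))`, there is
`ω` of finite order, unramified at every `v ∤ 𝔪` with `ω(ϖ_v) = ι(χ(Frob_v))⁻¹`, with `IsPAdicAvatarOf ι ω r`
(de Shalit's finite-order `χ` of conductor dividing `𝔣p^∞`, II.4.12–4.13).
[cite: deShalit1987, II.4.12–4.13 (p. 68–69)] [cite: NeukirchANT1999, Ch. VI §6 Def. (6.2) and Cor. (6.6)] -/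
theorem exists_isFiniteOrder_isPAdicAvatarOf_rayClassField (ι : PadicAlgCl p ≃+* ℂ) {𝔪 : Ideal (𝓞 K)}
    (h𝔪 : 𝔪 ≠ ⊥) (χ : (rayClassField K 𝔪 ≃ₐ[K] rayClassField K 𝔪) →* (PadicAlgCl p)ˣ)
    {r : FramedGaloisRep K (PadicAlgCl p) 1}
    (hr : ∀ γ : absoluteGaloisGroup K,
      r γ = FramedRep.unitsContinuousMulEquivOfUnique (Fin 1) (PadicAlgCl p)
        (χ (absRestrictNormalHom (rayClassField K 𝔪) γ))) :
    ∃ ω : HeckeCharacter K, ω.IsFiniteOrder ∧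
      (∀ v : HeightOneSpectrum (𝓞 K), ¬ 𝔪 ≤ v.asIdeal →
        ω.IsUnramifiedAt v ∧
          ω.valueAtUniformizer v =
            (ι ((χ (galFrob K (rayClassField K 𝔪) v) : (PadicAlgCl p)ˣ) : PadicAlgCl p))⁻¹) ∧
      IsPAdicAvatarOf ι ω r := by
  obtain ⟨ω, h1, h2, h3⟩ := exists_isFiniteOrder_isPAdicAvatarOf ι χ hr
  exact ⟨ω, h1, fun v hv ↦ h2 v (isUnramifiedIn_rayClassField h𝔪 hv), h3⟩


/-! ### §5. Bridge to the named API `inflateCharacterPadic` / `padicCharHecke` (appended)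

`GaloisRepresentations/FiniteGaloisCharacterPadicAvatar.lean` (cell `bsd-print-cf2`, seat `-w5` g15, landed the same
hour) names the two objects: `inflateCharacterPadic L χ` (= an `r` with `hr` by `rfl`) and
`padicCharHecke L ι χ := charHecke L ((Units.map ι) ∘ χ) hR`, whose avatar is `inflateCharacterPadic L χ⁻¹` — i.e.
**`padicCharHecke L ι χ` is the `ω` of this file for the character `χ⁻¹`**. The bridge below transports §3 to those
names and REMOVES the proviso "`L` unramified away from `p`" of `isPAdicAvatarOf_padicCharHecke` there. -/

section Bridge

variable [IsAbelianGalois K L] (ι : PadicAlgCl p ≃+* ℂ) (χ : (L ≃ₐ[K] L) →* (PadicAlgCl p)ˣ)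

omit [NumberField K] [NumberField L] [IsAbelianGalois K L] in
/-- `inflateCharacterPadic L χ` satisfies the hypothesis `hr` of this file. [cite: CasselsFrohlichANT1967, Ch. VII §3 (PDF p. 210)] -/
theorem inflateCharacterPadic_apply_eq [Normal K L] (γ : absoluteGaloisGroup K) :
    inflateCharacterPadic L χ γ =
      FramedRep.unitsContinuousMulEquivOfUnique (Fin 1) (PadicAlgCl p) (χ (absRestrictNormalHom L γ)) := rfl

omit [NumberField L] in
/-- **Convention dictionary**: `padicCharHecke L ι χ⁻¹` is the `ω` of this file,
`charHecke L ((Units.map ι) ∘ χ⁻¹) hR`. [cite: CasselsFrohlichANT1967, Ch. VII §4.2 Corollary (iii)] -/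
theorem padicCharHecke_inv_eq :
    padicCharHecke L ι χ⁻¹ =
      charHecke L ((Units.map (ι.toRingHom : PadicAlgCl p →* ℂ)).comp χ⁻¹) artinReciprocity_character_holds := rfl

/-- ★★ **`inflateCharacterPadic L χ⁻¹` IS the `p`-adic avatar of `padicCharHecke L ι χ`, for EVERY finite abelian `L`**
(no hypothesis on the ramification of `L` at the primes away from `p`: the relative avatar of the finite-order — hence
algebraic — character is its avatar, §3). [cite: SerreAbelianLadic1968, Ch. I §2.3, Ch. II §2.7]
[cite: CasselsFrohlichANT1967, Ch. VII §5.1 Main Theorem (A)] -/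
theorem isPAdicAvatarOf_padicCharHecke_inflateCharacterPadic_inv :
    IsPAdicAvatarOf ι (padicCharHecke L ι χ) (inflateCharacterPadic L χ⁻¹) := by
  have h := isPAdicAvatarOf_charHecke_inv ι (χ := χ⁻¹) (r := inflateCharacterPadic L χ⁻¹)
    (inflateCharacterPadic_apply_eq L χ⁻¹)
  have hχ : χ⁻¹⁻¹ = χ := MonoidHom.ext fun g ↦ by simp
  rwa [← padicCharHecke_inv_eq, hχ] at h

/-- **Uniqueness in the named API**: a Hecke character with avatar `inflateCharacterPadic L χ⁻¹` is
`padicCharHecke L ι χ`. [cite: CasselsFrohlichANT1967, Ch. VII Prop. 4.1 (uniqueness)] -/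
theorem eq_padicCharHecke_of_isPAdicAvatarOf {ω : HeckeCharacter K}
    (hω : IsPAdicAvatarOf ι ω (inflateCharacterPadic L χ⁻¹)) : ω = padicCharHecke L ι χ := by
  have h := eq_charHecke_inv_of_isPAdicAvatarOf ι (χ := χ⁻¹) (r := inflateCharacterPadic L χ⁻¹)
    (inflateCharacterPadic_apply_eq L χ⁻¹) hω
  have hχ : χ⁻¹⁻¹ = χ := MonoidHom.ext fun g ↦ by simp
  rwa [← padicCharHecke_inv_eq, hχ] at h

end Bridge

end Literature.NumberTheory.EllipticCurves

end
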